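import Literature.AlgebraicGeometry.Motives.HodgeStructureExteriorPowerLefschetzDual
import HarnessLib

/-!
# Venture HSemireg — the χ-PAIRING OF A `K`-SECANT CLASS in the wedge model (TRACK S4-PUSH (ii), seat `s4-prove-1`,
# ATTEMPT-2; companion of `SecantParityPositivity.lean`; files of record `s4push/prove-1/ATTEMPT-1.md` §1/§7,
# `theory/FORMULA-N-th7.md` §D (Σ6), `general-structure/STRUCTURE.md` §2 (S3))

HONEST FRAMING. Lean index of the computation cell `pub-hsemireg`. FINITE-DIMENSIONAL EXTERIOR ALGEBRA ONLY: for a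
module `W` with a basis `b` indexed by `Fin g ⊕ Fin g` and the tree's top trace `τ = ExteriorLefschetz.trace ω₀ g`
(`τ(ω₀ᵍ) = g!`, `ω₀ = twoVector b`), this file computes `τ(v^∨ · v)` for the "secant" elements
`v = xc·e^{B} + yc'·e^{B̄}`, `v^∨ := xc·e^{-B} + yc'·e^{-B̄}`, `B = a + t·β`, `B̄ = a - t·β` (`a, β ∈ ⋀² W`, scalars
`x, y, c, c', t`), where `e^{B} := Σ_{i ≤ g} Bⁱ/i!` (`expg`).  No abelian variety, sheaf, Chern character, Mukai
pairing, Euler pairing or Ext group is constructed; that `τ(v^∨ v)` IS the Euler pairing `χ(F, F)` of a sheaf with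
`ch(F) = v` (HRR on an abelian variety, `(e^B)^∨ = e^{-B}`, `y = x̄`, `c' = c̄`, `t = √-d`) is the PAPER dictionary of
FORMULA-N §D and is NOT formalised.  Nothing here says that HC, HC_CM or HC_AV holds; nothing here is a new case of anything.

*What it indexes (on paper).* th-7's (Σ6): `(ℓ,ℓ)_χ = 0`, `(ℓ,ℓ̄)_χ = |c|² ∫ e^{B̄-B} = |c|²(-2√-d)ⁿ∫bⁿ/n!`, hence
`(v,v)_χ = 2|xc|²(-4d)^{n/2}∫bⁿ/n!` for `n` even and `0` for `n` odd.  Here: **`trace_expg_mul_expg`** —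
`τ(e^{B₁} e^{B₂}) = τ((B₁ + B₂)ᵍ)/g!` for `B₁, B₂ ∈ ⋀² W` (only the bidegrees `i + j = g` reach the top; binomial theorem
for the commuting even elements); **`trace_secantDual_mul_secant`** — `τ(v^∨ v) = xc·yc'·((-2t)ᵍ + (2t)ᵍ)·τ(βᵍ)/g!`
(the `e^{∓B}e^{±B}` terms give `τ(0ᵍ) = 0` for `g ≥ 1`); **`trace_secantDual_mul_secant_even`** — for `g = 2m` and
`t² = -d`: `τ(v^∨ v) = 2·xc·yc'·(-4d)ᵐ·τ(βᵍ)/g!`, th-7's formula with `∫_X bⁿ ↦ τ(βᵍ)`; **`…_odd`** — `0` for `g` odd.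
Composed with `SecantParityPositivity.oneOneForm_pow_eq_det_smul_twoVector_pow` (`τ(βᵍ) = g!·det h` for `β` the
`(1,1)`-form with Hermitian matrix `h`) the sign of `τ(v^∨ v)` is `(-1)^{m + index(β)}` — the general parity
constraint `n/2 + index(b)` odd of ATTEMPT-1 §3, modulo HRR and the Ext profile (paper).

CONTENT (all PROVED, 0 sorry; definitions with bodies `expg`, `secant`, `secantDual`; no named facts), namespace
`Summit.Ventures.HSemireg.SecantParity`.  The COMPOSITION with `SecantParityPositivity` (`τ(βᵍ) = g!·det h` ⇒ `τ(v^∨ v) =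
2(xc)(yc')(-4d)ᵐ·det h`, its sign for `h` positive definite, the `sign_law` shape of `FormulaNUniformLaw.ParityDatum`, th-7's checker
numbers) is the separate leaf `SecantParitySignLaw.lean` (imports both files).

## References

* [Markman2025SecantWeil] E. Markman, arXiv:2502.03415 (UNREFEREED), §2.2 (pure spinors `e^B`), eq. (Mukai pairing).
* [HuybrechtsFM2006] D. Huybrechts, Fourier–Mukai transforms in algebraic geometry (2006), §5.2 (Mukai pairing,
  `v^∨`, `χ(E,F) = -⟨v(E), v(F)⟩`-type identities) — dictionary only.
* th-7, theory/FORMULA-N-th7.md §D; ref-4 13:46:16Z (H1).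
-/

noncomputable section

namespace Summit.Ventures.HSemireg

namespace SecantParity

open ExteriorAlgebra
open Literature.AlgebraicGeometry.Motives.ExteriorLefschetz (twoVector twoVector_mem pow_mem_exteriorPower
  isSymplectic_twoVector mul_comm_of_mem_two IsSymplectic trace trace_apply_of_mem_ne)

section CommRing

variable {K : Type*} [CommRing K] {W : Type*} [AddCommGroup W] [Module K W]

/-- `B₁ⁱ B₂ʲ ∈ ⋀^{2(i+j)} W` for `B₁, B₂ ∈ ⋀² W`. [cite: BourbakiAlgebraI1989, Ch. III §7 no. 1] -/
theorem pow_mul_pow_mem_of_mem_two {B₁ B₂ : ExteriorAlgebra K W} (h₁ : B₁ ∈ ⋀[K]^2 W) (h₂ : B₂ ∈ ⋀[K]^2 W)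
    (i j : ℕ) : B₁ ^ i * B₂ ^ j ∈ ⋀[K]^(2 * (i + j)) W := by
  have h := Submodule.mul_mem_mul (pow_mem_exteriorPower h₁ i) (pow_mem_exteriorPower h₂ j)
  rwa [← pow_add, ← mul_add] at h

/-- Sums, scalar multiples and negatives of elements of `⋀² W` (bookkeeping). [folklore] -/
theorem add_smul_mem_two {a β : ExteriorAlgebra K W} (ha : a ∈ ⋀[K]^2 W) (hβ : β ∈ ⋀[K]^2 W) (t : K) :
    a + t • β ∈ ⋀[K]^2 W ∧ a - t • β ∈ ⋀[K]^2 W ∧ -(a + t • β) ∈ ⋀[K]^2 W ∧ -(a - t • β) ∈ ⋀[K]^2 W :=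
  ⟨Submodule.add_mem _ ha (Submodule.smul_mem _ t hβ), Submodule.sub_mem _ ha (Submodule.smul_mem _ t hβ),
    Submodule.neg_mem _ (Submodule.add_mem _ ha (Submodule.smul_mem _ t hβ)),
    Submodule.neg_mem _ (Submodule.sub_mem _ ha (Submodule.smul_mem _ t hβ))⟩

end CommRing

section Field

variable {K : Type*} [Field K] [CharZero K] {W : Type*} [AddCommGroup W] [Module K W] {g : ℕ}
  (b : Module.Basis (Fin g ⊕ Fin g) K W)

/-- **The (truncated) exponential** `e^B := Σ_{i ≤ g} Bⁱ / i!` — for `B ∈ ⋀² W`, `dim W = 2g`, this is the whole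
exponential series since `B^{g+1} ∈ ⋀^{2g+2} W = 0` (`pow_succ_eq_zero_of_mem_two`); on paper `e^B` is the Chern
character of a line bundle / the even pure spinor of the graph of `B`. [cite: Markman2025SecantWeil, §2.2] -/
def expg (g : ℕ) (B : ExteriorAlgebra K W) : ExteriorAlgebra K W :=
  ∑ i ∈ Finset.range (g + 1), ((i.factorial : K)⁻¹) • B ^ i

omit [CharZero K] in
/-- `B^{g+1} = 0` for `B ∈ ⋀² W` when `W` has a basis of size `2g` (so `expg g B` is the full exponential series).
[cite: BourbakiAlgebraI1989, Ch. III §7 no. 1] -/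
theorem pow_succ_eq_zero_of_mem_two (b : Module.Basis (Fin g ⊕ Fin g) K W) {B : ExteriorAlgebra K W}
    (hB : B ∈ ⋀[K]^2 W) : B ^ (g + 1) = 0 := by
  have h : B ^ (g + 1) ∈ ⋀[K]^(2 * (g + 1)) W := pow_mem_exteriorPower hB (g + 1)
  rw [(isSymplectic_twoVector b).exteriorPower_eq_bot (by omega), Submodule.mem_bot] at h
  exact h

/-- The trace of `B₁ⁱ B₂ʲ` vanishes unless `i + j = g`. [cite: VoisinHodgeI2002, §6.3.2 (p. 128)] -/
theorem trace_pow_mul_pow_of_ne {B₁ B₂ : ExteriorAlgebra K W} (h₁ : B₁ ∈ ⋀[K]^2 W) (h₂ : B₂ ∈ ⋀[K]^2 W)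
    {i j : ℕ} (hij : i + j ≠ g) : trace (twoVector b) g (B₁ ^ i * B₂ ^ j) = 0 :=
  trace_apply_of_mem_ne (pow_mul_pow_mem_of_mem_two h₁ h₂ i j) (by omega)

omit [CharZero K] in
/-- `x · (n : ⋀W) = n • x`: a natural-number cast inside the algebra acts as a scalar. [folklore] -/
theorem mul_natCast_eq_smul (x : ExteriorAlgebra K W) (n : ℕ) : x * (n : ExteriorAlgebra K W) = (n : K) • x := by
  rw [← map_natCast (algebraMap K (ExteriorAlgebra K W)) n, ← Algebra.commutes, ← Algebra.smul_def]

/-- **`τ(e^{B₁} · e^{B₂}) = τ((B₁ + B₂)ᵍ) / g!`** for `B₁, B₂ ∈ ⋀² W`: in the product of the two exponential sums only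
the terms `B₁ⁱ B₂ʲ` with `i + j = g` have top degree, and `Σ_{i+j=g} B₁ⁱB₂ʲ/(i!j!) = (B₁+B₂)ᵍ/g!` by the binomial
theorem for the commuting even elements `B₁, B₂`. On paper: `∫ e^{B₁} e^{B₂} = ∫ e^{B₁+B₂} = ∫ (B₁+B₂)ⁿ/n!`.
[cite: Markman2025SecantWeil, §2.2] -/
theorem trace_expg_mul_expg {B₁ B₂ : ExteriorAlgebra K W} (h₁ : B₁ ∈ ⋀[K]^2 W) (h₂ : B₂ ∈ ⋀[K]^2 W) :
    trace (twoVector b) g (expg g B₁ * expg g B₂) =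
      ((g.factorial : K)⁻¹) * trace (twoVector b) g ((B₁ + B₂) ^ g) := by
  have hcomm : Commute B₁ B₂ := mul_comm_of_mem_two h₁ B₂
  -- expand the product of the two sums and apply the (linear) trace
  have hexp : expg g B₁ * expg g B₂ = ∑ i ∈ Finset.range (g + 1), ∑ j ∈ Finset.range (g + 1),
      (((i.factorial : K)⁻¹) * ((j.factorial : K)⁻¹)) • (B₁ ^ i * B₂ ^ j) := by
    unfold expg
    rw [Finset.sum_mul_sum]
    refine Finset.sum_congr rfl fun i _ ↦ Finset.sum_congr rfl fun j _ ↦ ?_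
    rw [smul_mul_smul_comm, mul_smul, smul_smul]
  rw [hexp, map_sum]
  simp_rw [map_sum, map_smul]
  -- only `j = g - i` survives in the inner sum
  have hinner : ∀ i ∈ Finset.range (g + 1), ∑ j ∈ Finset.range (g + 1),
      (((i.factorial : K)⁻¹) * ((j.factorial : K)⁻¹)) • trace (twoVector b) g (B₁ ^ i * B₂ ^ j) =
      (((i.factorial : K)⁻¹) * (((g - i).factorial : K)⁻¹)) • trace (twoVector b) g (B₁ ^ i * B₂ ^ (g - i)) := by
    intro i hi
    rw [Finset.mem_range] at hi
    rw [Finset.sum_eq_single (g - i)]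
    · intro j hj hji
      rw [trace_pow_mul_pow_of_ne b h₁ h₂ (by omega), smul_zero]
    · intro h
      exact absurd (Finset.mem_range.mpr (by omega)) h
  rw [Finset.sum_congr rfl hinner]
  -- the binomial theorem on the right
  rw [hcomm.add_pow, map_sum, Finset.mul_sum]
  refine Finset.sum_congr rfl fun i hi ↦ ?_
  rw [Finset.mem_range] at hi
  rw [mul_natCast_eq_smul, map_smul, smul_eq_mul, smul_eq_mul, ← mul_assoc, Nat.cast_choose K (by omega : i ≤ g)]
  congr 1
  have hg : (g.factorial : K) ≠ 0 := Nat.cast_ne_zero.mpr (Nat.factorial_pos g).ne'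
  have hi' : (i.factorial : K) ≠ 0 := Nat.cast_ne_zero.mpr (Nat.factorial_pos i).ne'
  have hgi : ((g - i).factorial : K) ≠ 0 := Nat.cast_ne_zero.mpr (Nat.factorial_pos (g - i)).ne'
  field_simp

/-- `τ(e^{-B} · e^{B}) = 0` for `B ∈ ⋀² W` and `g ≥ 1` (on paper `(ℓ,ℓ)_χ = |c|²∫e^{-B}e^{B} = |c|²∫1 = 0`).
[cite: Markman2025SecantWeil, §2.2] -/
theorem trace_expg_neg_mul_expg (hg : 0 < g) {B : ExteriorAlgebra K W} (hB : B ∈ ⋀[K]^2 W) :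
    trace (twoVector b) g (expg g (-B) * expg g B) = 0 := by
  rw [trace_expg_mul_expg b (Submodule.neg_mem _ hB) hB, neg_add_cancel, zero_pow hg.ne', map_zero, mul_zero]

/-- **The secant element** `v := (x c) • e^{a + t β} + (y c') • e^{a - t β}` (on paper: `v = xℓ + x̄ℓ̄`,
`ℓ = c·e^B`, `B = a + √-d·b`, `y = x̄`, `c' = c̄`, `t = √-d`). [cite: Markman2025SecantWeil, Assumption 2.4.1] -/
def secant (g : ℕ) (x y c c' t : K) (a β : ExteriorAlgebra K W) : ExteriorAlgebra K W :=
  (x * c) • expg g (a + t • β) + (y * c') • expg g (a - t • β)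

/-- **Its Mukai dual** `v^∨ := (x c) • e^{-(a + t β)} + (y c') • e^{-(a - t β)}` (on paper `(e^B)^∨ = e^{-B}`).
[cite: Markman2025SecantWeil, §2.2] -/
def secantDual (g : ℕ) (x y c c' t : K) (a β : ExteriorAlgebra K W) : ExteriorAlgebra K W :=
  (x * c) • expg g (-(a + t • β)) + (y * c') • expg g (-(a - t • β))

/-- **The χ-pairing of a secant class in the wedge model**: for `a, β ∈ ⋀² W`, `g ≥ 1`,
`τ(v^∨ · v) = (xc)(yc') · ((-2t)ᵍ + (2t)ᵍ) · τ(βᵍ) / g!` — the cross terms give `τ((∓2tβ)ᵍ)/g!`, the diagonal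
terms vanish. (th-7 §D: `(ℓ,ℓ̄)_χ + (ℓ̄,ℓ)_χ = |c|²[(-2√-d)ⁿ + (2√-d)ⁿ]∫bⁿ/n!`.)
[cite: Markman2025SecantWeil, §2.2 and Assumption 2.4.1] -/
theorem trace_secantDual_mul_secant (hg : 0 < g) (x y c c' t : K) {a β : ExteriorAlgebra K W}
    (ha : a ∈ ⋀[K]^2 W) (hβ : β ∈ ⋀[K]^2 W) :
    trace (twoVector b) g (secantDual g x y c c' t a β * secant g x y c c' t a β) =
      (x * c) * (y * c') * (((-2 * t) ^ g + (2 * t) ^ g) * (((g.factorial : K)⁻¹) *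
        trace (twoVector b) g (β ^ g))) := by
  obtain ⟨hB, hB', hnB, hnB'⟩ := add_smul_mem_two ha hβ t
  unfold secant secantDual
  simp only [add_mul, mul_add, smul_mul_smul_comm, map_add, map_smul]
  rw [trace_expg_neg_mul_expg b hg hB, trace_expg_neg_mul_expg b hg hB', smul_zero, smul_zero, zero_add, add_zero,
    trace_expg_mul_expg b hnB hB', trace_expg_mul_expg b hnB' hB]
  have h1 : -(a + t • β) + (a - t • β) = (-2 * t) • β := by
    rw [mul_smul, neg_smul, two_smul]; abel
  have h2 : -(a - t • β) + (a + t • β) = (2 * t) • β := by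
    rw [mul_smul, two_smul]; abel
  rw [h1, h2, smul_pow, smul_pow, map_smul, map_smul, smul_eq_mul, smul_eq_mul, smul_eq_mul, smul_eq_mul]
  ring

/-- **Even `g = 2m`, `t² = -d`**: `τ(v^∨ · v) = 2 (xc)(yc') (-4d)ᵐ · τ(βᵍ)/g!` — th-7's
`(v,v)_χ = 2|xc|²(-4d)^{n/2} ∫_X bⁿ/n!` with `∫_X bⁿ ↦ τ(βᵍ)`.  With `SecantParityPositivity` (`τ(βᵍ) = g!·det h`
for the `(1,1)`-form `β` with Hermitian matrix `h`): the sign of `τ(v^∨ v)` is `(-1)ᵐ · sign(det h) = (-1)^{m + index}`.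
[cite: Markman2025SecantWeil, §2.2 and Assumption 2.4.1] -/
theorem trace_secantDual_mul_secant_even {m : ℕ} (hg : g = 2 * m) (hm : 0 < m) (x y c c' t d : K)
    (ht : t ^ 2 = -d) {a β : ExteriorAlgebra K W} (ha : a ∈ ⋀[K]^2 W) (hβ : β ∈ ⋀[K]^2 W) :
    trace (twoVector b) g (secantDual g x y c c' t a β * secant g x y c c' t a β) =
      2 * ((x * c) * (y * c')) * (-4 * d) ^ m * (((g.factorial : K)⁻¹) * trace (twoVector b) g (β ^ g)) := by
  rw [trace_secantDual_mul_secant b (by omega) x y c c' t ha hβ]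
  have h1 : (-2 * t) ^ g + (2 * t) ^ g = 2 * (-4 * d) ^ m := by
    rw [hg, pow_mul, pow_mul, show (-2 * t) ^ 2 = -4 * d by linear_combination (4 : K) * ht,
      show (2 * t) ^ 2 = -4 * d by linear_combination (4 : K) * ht]
    ring
  rw [h1]
  ring

/-- **Odd `g`**: `τ(v^∨ · v) = 0` (th-7: "the Mukai pairing on `H^{ev}` of an odd-dimensional `X` is antisymmetric",
here simply `(-2t)ᵍ + (2t)ᵍ = 0`). [cite: Markman2025SecantWeil, §2.2] -/
theorem trace_secantDual_mul_secant_odd (hodd : Odd g) (x y c c' t : K) {a β : ExteriorAlgebra K W}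
    (ha : a ∈ ⋀[K]^2 W) (hβ : β ∈ ⋀[K]^2 W) :
    trace (twoVector b) g (secantDual g x y c c' t a β * secant g x y c c' t a β) = 0 := by
  rw [trace_secantDual_mul_secant b hodd.pos x y c c' t ha hβ, show (-2 * t) = -(2 * t) by ring, hodd.neg_pow,
    neg_add_cancel, zero_mul, mul_zero]

end Field

end SecantParity

end Summit.Ventures.HSemireg
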